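import Summits.QuantumFields.YangMills.Theorems.FluctuationComparisonRegPrIntLS2BetaRelativeTowerSupBudgetTheta
import Summits.QuantumFields.YangMills.Theorems.FluctuationComparisonRegPrIntLS2BetaLiftLadderCombRowTower
import Summits.QuantumFields.YangMills.Theorems.FluctuationComparisonRegPrIntLS2BetaLiftLadderArcProfile
import HarnessLib

/-!
# S2β · THE SUP CHAIN — THE THREE GUARD LETTERS AT A GENERIC THRESHOLD PROFILE `θ′` (ARC-PROFILE, COMB-ROW′ from the guard, (RSP-Σ)):
# ✓p832020 ∕ ✓p832427 ∕ ✓p833422 re-composed over the θ-generic sup budget `exists_supBudget_128_theta` — NO `γ, b₀, p₀`; windows `θ′(i) ≤ a₀(L)`, `Σ_{i<K−J} θ′(K−i) ≤ S₀(L)`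

Cell `ym3-torus` (YM ladder rung R3 = continuum `SU(2)` Yang–Mills on the three-torus at fixed lattice data — a RUNG: NOT d = 4, NOT infinite volume, NOT a mass gap,
NOT Clay).  Width seat «width 12» `ym3-torus-px12` (gen 26), FREE px helper on crux `stmt-QuantumFields-20520`; `--kind proof --supports stmt-QuantumFields-20520 --as
helper`, count-neutral, DEFINITION-FREE (0 `def`, 0 `instance`, 0 `notation`, 0 `sorry`, default heartbeats).

WHY (architect 20:11:52Z: the LIFT-LADDER letters' prefix `∀ L > 1, ∀ C_B ≥ 0, ∃ α₀ ∃ A ∃ β ∃ C ∃ c, ∀ F … θ … α …` carries NO `b₀, p₀, γ` — an inhabitant at generic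
`θ` cannot call the `θBal` editions).  The three letters of this seat that read the DATUM's small-bond guard — the arc profile (`hArc` of ✓`combRow'`), COMB-ROW′ from the
guard, (RSP-Σ) — are here restated and reproved with `(γ, b₀, p₀, θBal, γ₁)` replaced by `(θ′, a₀(L), S₀(L))`; proofs are the landed proofs with the root swapped
(✓`exists_gamma_supBudget_128` → `exists_supBudget_128_theta`) and the fibre mate's `histGood θ′` membership via the θ-generic ✓`gaugeAct_mem_histGood_iff`.
The `θBal` editions are the special case `θ′ := θBal L γ b₀ p₀ (·)` with ✓`thresholdSum_small` supplying the two windows for `γ ≤ γ₁`.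

WHAT IS PROVED (sorry-free).  ★★`arcProfile_theta`, ★★★`arcProfile_theta_axStage` (every gauged level `1 ≤ i < K−J` of both towers has arcs `≤ 1∕4`),
★★★`combRow'_theta` (the `hCOMB` binder of ✓p831454∕✓p832110 with `A := (11∕10·L⁻¹)²`), ★★★`relChordSum_theta_axStage` (`∃ M, … ∧ Σ_{t<K−J} M(t+1) ≤ E(L)`).

HONEST SCOPE.  Re-compositions; windows, guard, memberships, `AxStage` rows HYPOTHESES; nothing of Bałaban's renormalisation-group analysis is asserted or proved
([Balaban1985RegularSpaces] Lemma 1 (1.24)–(1.26) p.79, (1.29) p.81; [Balaban1985Averaging] Prop. 4 (128)–(135) pp.37–38 — printed conventions); LIFT-LADDER's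
inhabitant, (ST″), LOC, D-GUARD, GAP♯∘ (`stub_uniformFibreGapOrbit`, registry 3732b7df UNTOUCHED), the five registered stubs (0∕5), S2β, 20520, 19936, 19200, `YM3TorusSU2`
are NOT proved; no registered stub is closed; rung R3 — NOT d = 4, NOT infinite volume, NOT a mass gap, NOT Clay; the Yang–Mills mass gap is NOT proved.
-/

set_option autoImplicit false

noncomputable section

namespace Summit.QuantumFields.YangMills.Theorems.FluctuationComparisonRegPrIntLS2BetaGuardLettersTheta

open Finset
open scoped Real
open Literature.MathematicalPhysics.QuantumLattice (su2Quat)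
open Literature.MathematicalPhysics.QuantumFieldTheory.Balaban1983to89
open T4Continuum T3ContinuumYM3Torus T3UnitScaleTilt T3TiltDescent T3LevelShift BlockAveraging
open T4CubeChartGnomonic (SU2)
open T4HaarSU2ExpChart (expPoint)
open T4ExpWindowSmallField (logVec)
open T3UnitLawDensityEML (ℰp)
open T3ConstrainedMinimiser (fibre)
open B10Eq27TorusAxialLog (rel axialT)
open Summit.QuantumFields.YangMills.Theorems.FluctuationComparisonRegPrIntLS2BetaRelativeTowerSupBudgetTheta (exists_supBudget_128_theta)
open Summit.QuantumFields.YangMills.Theorems.FluctuationComparisonRegPrIntLS2BetaResidualGauge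
  (gaugeAct_mul_eq gaugeAct_inv_gaugeAct gaugeAct_mem_fibre_iff_of_residual gaugeAct_mem_histGood_iff)
open Summit.QuantumFields.YangMills.Theorems.FluctuationComparisonRegPrIntLS2BetaHFlatOfRelativeLetter (residual_of_iter_eq)

open Summit.QuantumFields.YangMills.Theorems.FluctuationComparisonRegPrIntLS2BetaLiftLadderCombRow (norm_logVec_rawChord_eq_stageChord norm_logVec_mul_inv_le_add)

open Summit.QuantumFields.YangMills.Theorems.FluctuationComparisonRegPrIntLS2BetaLiftLadderCombRowTower (combRow')

/-! ## §1 The arc profile of two stage towers over a small-bond datum -/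

/-- ★★ **THE ARC PROFILE, θ-GENERIC**: as ✓p832020 `arcProfile_of_smallBond` with `(γ, b₀, p₀, θBal, γ₁)` replaced by an arbitrary threshold profile `θ′ ≥ 0`
inside the windows `θ′(i) ≤ a₀(L)`, `Σ_{i<K−J} θ′(K−i) ≤ S₀(L)` (✓`exists_supBudget_128_theta` ×2). [cite: Balaban1985RegularSpaces, Lemma 1 (1.24)-(1.26) p.79, (1.29) p.81] -/
theorem arcProfile_theta (L : ℕ) (hL : 1 < L) :
    ∃ a₀ : ℝ, 0 < a₀ ∧ ∃ S₀ : ℝ, 0 < S₀ ∧ ∀ (F : T3Family) (θ' : ℕ → ℝ), F.L = L → (∀ i, 0 ≤ θ' i) → (∀ i, θ' i ≤ a₀) →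
      ∀ (J K : ℕ) (hJK : J ≤ K), ∑ i ∈ Finset.range (K - J), θ' (K - i) ≤ S₀ → ∀ (V : GaugeField (F.P J) 0 SU2), (∀ e, ‖logVec (su2Quat (V e))‖ ≤ 1 / 128) →
      ∀ (W U₁ : GaugeField (F.P K) 0 SU2), W ∈ fibre F ℰp J K hJK V → W ∈ histGood F ℰp θ' K J →
        U₁ ∈ fibre F ℰp J K hJK V → U₁ ∈ histGood F ℰp θ' K J →
      ∀ (wt : (j : ℕ) → PBond (F.P K) j → PBond (F.P K) (j + 1) → ℝ)
        (lift : (j : ℕ) → GaugeField (F.P K) (j + 1) SU2 → GaugeField (F.P K) j SU2) (g g₀ : (j : ℕ) → Site (F.P K) j → SU2),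
        (∀ j b e, wt j b e = if e.dir = b.dir ∧ (b.src b.dir - emb e.src b.dir).val < (F.P K).L then
          ∏ ν ∈ Finset.univ.erase b.dir, max 0 (1 - ((rel (emb e.src) b.src ν).natAbs : ℝ) / (F.P K).L) else 0) →
        (∀ j X b, lift j X b = expPoint (∑ e, wt j b e • ((((F.P K).L : ℕ) : ℝ)⁻¹ • logVec (su2Quat (X e))))) →
        (∀ j, K - J ≤ j → ∀ y, g j y = 1) →
        (∀ j, j < K - J → ∀ x,
          axialT (GaugeField.gaugeAct (g j) (Averaging.iter (fun k => blockAvg (P := F.P K) (j := k) ℰp) j W)) (emb (blockOf x)) x =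
            axialT (lift j (GaugeField.gaugeAct (g (j + 1)) (Averaging.iter (fun k => blockAvg (P := F.P K) (j := k) ℰp) (j + 1) W))) (emb (blockOf x)) x) →
        (∀ j, j < K - J →
          (blockAvg (P := F.P K) (j := j) ℰp).avg (GaugeField.gaugeAct (g j) (Averaging.iter (fun k => blockAvg (P := F.P K) (j := k) ℰp) j W)) =
            GaugeField.gaugeAct (g (j + 1)) (Averaging.iter (fun k => blockAvg (P := F.P K) (j := k) ℰp) (j + 1) W)) →
        (∀ j, K - J ≤ j → ∀ y, g₀ j y = 1) →
        (∀ j, j < K - J → ∀ x,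
          axialT (GaugeField.gaugeAct (g₀ j) (Averaging.iter (fun k => blockAvg (P := F.P K) (j := k) ℰp) j U₁)) (emb (blockOf x)) x =
            axialT (lift j (GaugeField.gaugeAct (g₀ (j + 1)) (Averaging.iter (fun k => blockAvg (P := F.P K) (j := k) ℰp) (j + 1) U₁))) (emb (blockOf x)) x) →
        (∀ j, j < K - J →
          (blockAvg (P := F.P K) (j := j) ℰp).avg (GaugeField.gaugeAct (g₀ j) (Averaging.iter (fun k => blockAvg (P := F.P K) (j := k) ℰp) j U₁)) =
            GaugeField.gaugeAct (g₀ (j + 1)) (Averaging.iter (fun k => blockAvg (P := F.P K) (j := k) ℰp) (j + 1) U₁)) →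
        ∀ i, 1 ≤ i → i < K - J → ∀ e : PBond (F.P K) i,
          ‖logVec (su2Quat (GaugeField.gaugeAct (g i) (Averaging.iter (fun k => blockAvg (P := F.P K) (j := k) ℰp) i W) e))‖ ≤ 1 / 4 ∧
          ‖logVec (su2Quat (GaugeField.gaugeAct (g₀ i) (Averaging.iter (fun k => blockAvg (P := F.P K) (j := k) ℰp) i U₁) e))‖ ≤ 1 / 4 := by
  obtain ⟨E, _hE, a₀, ha₀, S₀, hS₀, H⟩ := exists_supBudget_128_theta L hL
  refine ⟨a₀, ha₀, S₀, hS₀, ?_⟩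
  intro F θ' hFL hθ0 hθa J K hJK hθS V hV W U₁ hWf hWg hU₁f hU₁g wt lift g g₀ hwt hlift hT1 hT4 hT5 hT1' hT4' hT5' i hi1 hiK e
  -- the first tower `(g, W)`
  obtain ⟨s, _hs0, hs, hs4, _, _⟩ := H F θ' hFL hθ0 hθa J K hJK hθS V hV W hWf hWg g wt
    (fun t => lift t (GaugeField.gaugeAct (g (t + 1)) (Averaging.iter (fun k => blockAvg (P := F.P K) (j := k) ℰp) (t + 1) W)))
    (fun t _ b e => hwt t b e) (fun t _ b => hlift t _ b) hT1 (fun t ht z => hT4 t ht z) (fun t ht => hT5 t ht)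
  -- the second tower `(g₀, U₁)`
  obtain ⟨s', _hs0', hs', hs4', _, _⟩ := H F θ' hFL hθ0 hθa J K hJK hθS V hV U₁ hU₁f hU₁g g₀ wt
    (fun t => lift t (GaugeField.gaugeAct (g₀ (t + 1)) (Averaging.iter (fun k => blockAvg (P := F.P K) (j := k) ℰp) (t + 1) U₁)))
    (fun t _ b e => hwt t b e) (fun t _ b => hlift t _ b) hT1' (fun t ht z => hT4' t ht z) (fun t ht => hT5' t ht)
  exact ⟨(hs i hiK.le e).trans (hs4 i hiK.le), (hs' i hiK.le e).trans (hs4' i hiK.le)⟩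

/-! ## §2 The same with the second tower's memberships derived from the `AxStage` bottom relation -/

/-- ★★★ **THE ARC PROFILE, θ-GENERIC, `AxStage` EDITION**: as ✓p832020 `arcProfile_of_smallBond_axStage` at an arbitrary `θ′` in the two windows; the fibre mate's
`histGood θ′` membership via the θ-generic ✓`gaugeAct_mem_histGood_iff`. [cite: Balaban1985RegularSpaces, Lemma 1 (1.24)-(1.26) p.79, (1.29) p.81] -/
theorem arcProfile_theta_axStage (L : ℕ) (hL : 1 < L) :
    ∃ a₀ : ℝ, 0 < a₀ ∧ ∃ S₀ : ℝ, 0 < S₀ ∧ ∀ (F : T3Family) (θ' : ℕ → ℝ), F.L = L → (∀ i, 0 ≤ θ' i) → (∀ i, θ' i ≤ a₀) →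
      ∀ (J K : ℕ) (hJK : J ≤ K), ∑ i ∈ Finset.range (K - J), θ' (K - i) ≤ S₀ → ∀ (V : GaugeField (F.P J) 0 SU2), (∀ e, ‖logVec (su2Quat (V e))‖ ≤ 1 / 128) →
      ∀ (W U₀ : GaugeField (F.P K) 0 SU2), W ∈ fibre F ℰp J K hJK V → W ∈ histGood F ℰp θ' K J →
        U₀ ∈ fibre F ℰp J K hJK V → U₀ ∈ histGood F ℰp θ' K J →
      ∀ (wt : (j : ℕ) → PBond (F.P K) j → PBond (F.P K) (j + 1) → ℝ)
        (lift : (j : ℕ) → GaugeField (F.P K) (j + 1) SU2 → GaugeField (F.P K) j SU2)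
        (U₁ : GaugeField (F.P K) 0 SU2) (g g₀ : (j : ℕ) → Site (F.P K) j → SU2),
        (∀ j b e, wt j b e = if e.dir = b.dir ∧ (b.src b.dir - emb e.src b.dir).val < (F.P K).L then
          ∏ ν ∈ Finset.univ.erase b.dir, max 0 (1 - ((rel (emb e.src) b.src ν).natAbs : ℝ) / (F.P K).L) else 0) →
        (∀ j X b, lift j X b = expPoint (∑ e, wt j b e • ((((F.P K).L : ℕ) : ℝ)⁻¹ • logVec (su2Quat (X e))))) →
        (∀ j, K - J ≤ j → ∀ y, g j y = 1) →
        (∀ j, j < K - J → ∀ x,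
          axialT (GaugeField.gaugeAct (g j) (Averaging.iter (fun k => blockAvg (P := F.P K) (j := k) ℰp) j W)) (emb (blockOf x)) x =
            axialT (lift j (GaugeField.gaugeAct (g (j + 1)) (Averaging.iter (fun k => blockAvg (P := F.P K) (j := k) ℰp) (j + 1) W))) (emb (blockOf x)) x) →
        (∀ j, j < K - J →
          (blockAvg (P := F.P K) (j := j) ℰp).avg (GaugeField.gaugeAct (g j) (Averaging.iter (fun k => blockAvg (P := F.P K) (j := k) ℰp) j W)) =
            GaugeField.gaugeAct (g (j + 1)) (Averaging.iter (fun k => blockAvg (P := F.P K) (j := k) ℰp) (j + 1) W)) →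
        (∀ j, K - J ≤ j → ∀ y, g₀ j y = 1) →
        (∀ j, j < K - J → ∀ x,
          axialT (GaugeField.gaugeAct (g₀ j) (Averaging.iter (fun k => blockAvg (P := F.P K) (j := k) ℰp) j U₁)) (emb (blockOf x)) x =
            axialT (lift j (GaugeField.gaugeAct (g₀ (j + 1)) (Averaging.iter (fun k => blockAvg (P := F.P K) (j := k) ℰp) (j + 1) U₁))) (emb (blockOf x)) x) →
        (∀ j, j < K - J →
          (blockAvg (P := F.P K) (j := j) ℰp).avg (GaugeField.gaugeAct (g₀ j) (Averaging.iter (fun k => blockAvg (P := F.P K) (j := k) ℰp) j U₁)) =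
            GaugeField.gaugeAct (g₀ (j + 1)) (Averaging.iter (fun k => blockAvg (P := F.P K) (j := k) ℰp) (j + 1) U₁)) →
        (∀ X : GaugeField (F.P K) 0 SU2, Averaging.iter (fun k => blockAvg (P := F.P K) (j := k) ℰp) (K - J) (GaugeField.gaugeAct (fun x => (g 0 x)⁻¹) X) =
          Averaging.iter (fun k => blockAvg (P := F.P K) (j := k) ℰp) (K - J) X) →
        (∀ X : GaugeField (F.P K) 0 SU2, Averaging.iter (fun k => blockAvg (P := F.P K) (j := k) ℰp) (K - J) (GaugeField.gaugeAct (g₀ 0) X) =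
          Averaging.iter (fun k => blockAvg (P := F.P K) (j := k) ℰp) (K - J) X) →
        U₀ = GaugeField.gaugeAct (fun x => (g 0 x)⁻¹ * g₀ 0 x) U₁ →
        ∀ i, 1 ≤ i → i < K - J → ∀ e : PBond (F.P K) i,
          ‖logVec (su2Quat (GaugeField.gaugeAct (g i) (Averaging.iter (fun k => blockAvg (P := F.P K) (j := k) ℰp) i W) e))‖ ≤ 1 / 4 ∧
          ‖logVec (su2Quat (GaugeField.gaugeAct (g₀ i) (Averaging.iter (fun k => blockAvg (P := F.P K) (j := k) ℰp) i U₁) e))‖ ≤ 1 / 4 := by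
  obtain ⟨a₀, ha₀, S₀, hS₀, H⟩ := arcProfile_theta L hL
  refine ⟨a₀, ha₀, S₀, hS₀, ?_⟩
  intro F θ' hFL hθ0 hθa J K hJK hθS V hV W U₀ hWf hWg hU₀f hU₀g wt lift U₁ g g₀ hwt hlift hT1 hT4 hT5 hT1' hT4' hT5' hT6 hT5r hU₀
  -- the residual transformation `w := g_0⁻¹·g₀_0` and `U₁ = w⁻¹ • U₀`
  have hwres : ∀ X : GaugeField (F.P K) 0 SU2,
      descendTo F ℰp J K hJK (GaugeField.gaugeAct (fun x => (g 0 x)⁻¹ * g₀ 0 x) X) = descendTo F ℰp J K hJK X := by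
    refine residual_of_iter_eq F hJK _ fun X => ?_
    have e1 : GaugeField.gaugeAct (fun x => (g 0 x)⁻¹ * g₀ 0 x) X =
        GaugeField.gaugeAct (fun x => (g 0 x)⁻¹) (GaugeField.gaugeAct (g₀ 0) X) := gaugeAct_mul_eq (fun x => (g 0 x)⁻¹) (g₀ 0) X
    rw [e1, hT6, hT5r]
  have hU₁f : U₁ ∈ fibre F ℰp J K hJK V := by
    rw [← gaugeAct_mem_fibre_iff_of_residual F hJK hwres U₁, ← hU₀]; exact hU₀f
  have hU₁g : U₁ ∈ histGood F ℰp θ' K J := by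
    rw [← gaugeAct_mem_histGood_iff F (fun x => (g 0 x)⁻¹ * g₀ 0 x) θ' J U₁, ← hU₀]; exact hU₀g
  exact H F θ' hFL hθ0 hθa J K hJK hθS V hV W U₁ hWf hWg hU₁f hU₁g wt lift g g₀ hwt hlift hT1 hT4 hT5 hT1' hT4' hT5'


/-- ★★★ **COMB-ROW′ FROM THE GUARD, θ-GENERIC**: ✓p831621 `combRow'` ∘ `arcProfile_theta_axStage` — ✓p832427 `combRow'_of_smallBond` with `(γ, b₀, p₀, θBal, γ₁)` replaced
by `(θ′, a₀, S₀)`; conclusion (the `hCOMB` binder, `A := (11∕10·L⁻¹)²`) byte-identical. [cite: Balaban1985RegularSpaces, (1.29) p.81; Balaban1985Averaging, Prop. 4 (128)-(135) p.37-38] -/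
theorem combRow'_theta (L : ℕ) (hL : 1 < L) :
    ∃ a₀ : ℝ, 0 < a₀ ∧ ∃ S₀ : ℝ, 0 < S₀ ∧ ∀ (F : T3Family) (θ' : ℕ → ℝ), F.L = L → (∀ i, 0 ≤ θ' i) → (∀ i, θ' i ≤ a₀) →
      ∀ (J K : ℕ) (hJK : J ≤ K), ∑ i ∈ Finset.range (K - J), θ' (K - i) ≤ S₀ → ∀ (V : GaugeField (F.P J) 0 SU2), (∀ e, ‖logVec (su2Quat (V e))‖ ≤ 1 / 128) →
      ∀ (U₀ : GaugeField (F.P K) 0 (Matrix.specialUnitaryGroup (Fin 2) ℂ)) (ζ : PBond (F.P K) 0 → EuclideanSpace ℝ (Fin 3)),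
        (fun ℓ => expPoint (ζ ℓ) * U₀ ℓ : GaugeField (F.P K) 0 SU2) ∈ fibre F ℰp J K hJK V →
        (fun ℓ => expPoint (ζ ℓ) * U₀ ℓ : GaugeField (F.P K) 0 SU2) ∈ histGood F ℰp θ' K J →
        U₀ ∈ fibre F ℰp J K hJK V → U₀ ∈ histGood F ℰp θ' K J →
      ∀ (wt : (j : ℕ) → PBond (F.P K) j → PBond (F.P K) (j + 1) → ℝ)
        (lift : (j : ℕ) → GaugeField (F.P K) (j + 1) SU2 → GaugeField (F.P K) j SU2)
        (U₁ : GaugeField (F.P K) 0 SU2) (g g₀ : (j : ℕ) → Site (F.P K) j → SU2),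
        (∀ j b e, wt j b e = if e.dir = b.dir ∧ (b.src b.dir - emb e.src b.dir).val < (F.P K).L then
          ∏ ν ∈ Finset.univ.erase b.dir, max 0 (1 - ((rel (emb e.src) b.src ν).natAbs : ℝ) / (F.P K).L) else 0) →
        (∀ j X b, lift j X b = expPoint (∑ e, wt j b e • ((((F.P K).L : ℕ) : ℝ)⁻¹ • logVec (su2Quat (X e))))) →
        (∀ j, j < K - J → ∀ x, g j x =
          (axialT (lift j (GaugeField.gaugeAct (g (j + 1)) (Averaging.iter (fun k => blockAvg (P := F.P K) (j := k) ℰp) (j + 1) (fun ℓ => expPoint (ζ ℓ) * U₀ ℓ))))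
              (emb (blockOf x)) x)⁻¹ *
            g (j + 1) (blockOf x) * axialT (Averaging.iter (fun k => blockAvg (P := F.P K) (j := k) ℰp) j (fun ℓ => expPoint (ζ ℓ) * U₀ ℓ)) (emb (blockOf x)) x) →
        (∀ j, K - J ≤ j → ∀ y, g j y = 1) →
        (∀ j, j < K - J → ∀ y : Site (F.P K) (j + 1), g j (emb y) = g (j + 1) y) →
        (∀ X : GaugeField (F.P K) 0 SU2, ∀ j, j ≤ K - J →
          Averaging.iter (fun k => blockAvg (P := F.P K) (j := k) ℰp) j (GaugeField.gaugeAct (g 0) X) =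
            GaugeField.gaugeAct (g j) (Averaging.iter (fun k => blockAvg (P := F.P K) (j := k) ℰp) j X)) →
        (∀ j, j < K - J → ∀ x,
          axialT (GaugeField.gaugeAct (g j) (Averaging.iter (fun k => blockAvg (P := F.P K) (j := k) ℰp) j (fun ℓ => expPoint (ζ ℓ) * U₀ ℓ))) (emb (blockOf x)) x =
            axialT (lift j (GaugeField.gaugeAct (g (j + 1)) (Averaging.iter (fun k => blockAvg (P := F.P K) (j := k) ℰp) (j + 1) (fun ℓ => expPoint (ζ ℓ) * U₀ ℓ))))
              (emb (blockOf x)) x) →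
        (∀ j, j < K - J →
          (blockAvg (P := F.P K) (j := j) ℰp).avg (GaugeField.gaugeAct (g j) (Averaging.iter (fun k => blockAvg (P := F.P K) (j := k) ℰp) j (fun ℓ => expPoint (ζ ℓ) * U₀ ℓ))) =
            GaugeField.gaugeAct (g (j + 1)) (Averaging.iter (fun k => blockAvg (P := F.P K) (j := k) ℰp) (j + 1) (fun ℓ => expPoint (ζ ℓ) * U₀ ℓ))) →
        (∀ j, j < K - J → ∀ x, g₀ j x =
          (axialT (lift j (GaugeField.gaugeAct (g₀ (j + 1)) (Averaging.iter (fun k => blockAvg (P := F.P K) (j := k) ℰp) (j + 1) U₁)))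
              (emb (blockOf x)) x)⁻¹ *
            g₀ (j + 1) (blockOf x) * axialT (Averaging.iter (fun k => blockAvg (P := F.P K) (j := k) ℰp) j U₁) (emb (blockOf x)) x) →
        (∀ j, K - J ≤ j → ∀ y, g₀ j y = 1) →
        (∀ j, j < K - J → ∀ y : Site (F.P K) (j + 1), g₀ j (emb y) = g₀ (j + 1) y) →
        (∀ X : GaugeField (F.P K) 0 SU2, ∀ j, j ≤ K - J →
          Averaging.iter (fun k => blockAvg (P := F.P K) (j := k) ℰp) j (GaugeField.gaugeAct (g₀ 0) X) =
            GaugeField.gaugeAct (g₀ j) (Averaging.iter (fun k => blockAvg (P := F.P K) (j := k) ℰp) j X)) →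
        (∀ j, j < K - J → ∀ x,
          axialT (GaugeField.gaugeAct (g₀ j) (Averaging.iter (fun k => blockAvg (P := F.P K) (j := k) ℰp) j U₁)) (emb (blockOf x)) x =
            axialT (lift j (GaugeField.gaugeAct (g₀ (j + 1)) (Averaging.iter (fun k => blockAvg (P := F.P K) (j := k) ℰp) (j + 1) U₁))) (emb (blockOf x)) x) →
        (∀ j, j < K - J →
          (blockAvg (P := F.P K) (j := j) ℰp).avg (GaugeField.gaugeAct (g₀ j) (Averaging.iter (fun k => blockAvg (P := F.P K) (j := k) ℰp) j U₁)) =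
            GaugeField.gaugeAct (g₀ (j + 1)) (Averaging.iter (fun k => blockAvg (P := F.P K) (j := k) ℰp) (j + 1) U₁)) →
        (∀ X : GaugeField (F.P K) 0 SU2, Averaging.iter (fun k => blockAvg (P := F.P K) (j := k) ℰp) (K - J) (GaugeField.gaugeAct (fun x => (g 0 x)⁻¹) X) =
          Averaging.iter (fun k => blockAvg (P := F.P K) (j := k) ℰp) (K - J) X) →
        (∀ X : GaugeField (F.P K) 0 SU2, Averaging.iter (fun k => blockAvg (P := F.P K) (j := k) ℰp) (K - J) (GaugeField.gaugeAct (g₀ 0) X) =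
          Averaging.iter (fun k => blockAvg (P := F.P K) (j := k) ℰp) (K - J) X) →
        U₀ = GaugeField.gaugeAct (fun x => (g 0 x)⁻¹ * g₀ 0 x) U₁ →
        3 ≤ F.L →
    ∀ (t : ℕ) (ht1 : t + 1 < K - J),
      (fun (t : ℕ) (ht : t < K - J) => ∑ B : PBond (F.P J) 0,
            ‖(fun ℓ' : PBond (F.P (J + (t + 1))) 0 =>
              if (∃ z : Site (F.P (J + (t + 1))) 0,
                (B14.Eq22Determines.blockIter (t + 1) z = (bondShift (F.sitesPerDir_eq (m := F.m) (K := J) (j := 0) (m' := F.m) (K' := J + (t + 1)) (j' := t + 1) (by omega)) B).src ∨ B14.Eq22Determines.blockIter (t + 1) z = (bondShift (F.sitesPerDir_eq (m := F.m) (K := J) (j := 0) (m' := F.m) (K' := J + (t + 1)) (j' := t + 1) (by omega)) B).tgt) ∧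
                ∀ ν, (B10Eq27TorusAxialLog.rel z ℓ'.src ν).natAbs ≤ 2) ∧
                (blockOf (ℓ'.src.shift ℓ'.dir) = blockOf ℓ'.src ∧ ∀ ν, ν < ℓ'.dir → B10Eq27TorusAxialLog.rel (emb (blockOf ℓ'.src)) ℓ'.src ν = 0)
              then logVec (su2Quat (descendTo F ℰp (J + (t + 1)) K (by omega) (fun ℓ => expPoint (ζ ℓ) * U₀ ℓ : GaugeField (F.P K) 0 (Matrix.specialUnitaryGroup (Fin 2) ℂ)) ℓ' * (descendTo F ℰp (J + (t + 1)) K (by omega) U₀ ℓ')⁻¹)) else 0)‖ ^ 2) (t + 1) ht1 ≤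
        (11 / 10 * (F.L : ℝ)⁻¹) ^ 2 * (fun (t : ℕ) (ht : t < K - J) => ∑ B : PBond (F.P J) 0,
            ‖(fun ℓ' : PBond (F.P (J + (t + 1))) 0 =>
              if ∃ z : Site (F.P (J + (t + 1))) 0,
                (B14.Eq22Determines.blockIter (t + 1) z = (bondShift (F.sitesPerDir_eq (m := F.m) (K := J) (j := 0) (m' := F.m) (K' := J + (t + 1)) (j' := t + 1) (by omega)) B).src ∨ B14.Eq22Determines.blockIter (t + 1) z = (bondShift (F.sitesPerDir_eq (m := F.m) (K := J) (j := 0) (m' := F.m) (K' := J + (t + 1)) (j' := t + 1) (by omega)) B).tgt) ∧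
                ∀ ν, (B10Eq27TorusAxialLog.rel z ℓ'.src ν).natAbs ≤ 2
              then logVec (su2Quat (descendTo F ℰp (J + (t + 1)) K (by omega) (fun ℓ => expPoint (ζ ℓ) * U₀ ℓ : GaugeField (F.P K) 0 (Matrix.specialUnitaryGroup (Fin 2) ℂ)) ℓ' * (descendTo F ℰp (J + (t + 1)) K (by omega) U₀ ℓ')⁻¹)) else 0)‖ ^ 2) t (Nat.lt_of_succ_lt ht1) := by
  obtain ⟨a₀, ha₀, S₀, hS₀, H⟩ := arcProfile_theta_axStage L hL
  refine ⟨a₀, ha₀, S₀, hS₀, ?_⟩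
  intro F θ' hFL hθ0 hθa J K hJK hθS V hV U₀ ζ hWf hWg hU₀f hU₀g wt lift U₁ g g₀ hwt hlift hT0 hT1 hT2 hT3 hT4 hT5 hT0' hT1' hT2' hT3' hT4' hT5' hT6 hT5r hU₀ hL3
  have hL2 : 2 ≤ F.L := by omega
  exact combRow' hJK U₀ ζ wt lift U₁ g g₀ hwt hlift hT3 hT4 hT3' hT4' hU₀ hL2 (le_refl (1 / 4 : ℝ))
    (H F θ' hFL hθ0 hθa J K hJK hθS V hV _ U₀ hWf hWg hU₀f hU₀g wt lift U₁ g g₀ hwt hlift hT1 hT4 hT5 hT1' hT4' hT5' hT6 hT5r hU₀)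


/-- ★★★ **(RSP-Σ), θ-GENERIC**: ✓p833422 `relChordSum_of_smallBond_axStage` with `(γ, b₀, p₀, θBal, γ₁)` replaced by `(θ′, a₀, S₀)`: per-level sups `M_t ≤ 1∕2` of the
relative stage chords with `Σ_{t<K−J} M(t+1) ≤ E(L)` (✓`exists_supBudget_128_theta` ×2 + the arc triangle). [cite: Balaban1985RegularSpaces, Lemma 1 (1.24)-(1.26) p.79, (1.29) p.81] -/
theorem relChordSum_theta_axStage (L : ℕ) (hL : 1 < L) :
    ∃ E : ℝ, 0 ≤ E ∧ ∃ a₀ : ℝ, 0 < a₀ ∧ ∃ S₀ : ℝ, 0 < S₀ ∧ ∀ (F : T3Family) (θ' : ℕ → ℝ), F.L = L → (∀ i, 0 ≤ θ' i) → (∀ i, θ' i ≤ a₀) →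
      ∀ (J K : ℕ) (hJK : J ≤ K), ∑ i ∈ Finset.range (K - J), θ' (K - i) ≤ S₀ → ∀ (V : GaugeField (F.P J) 0 SU2), (∀ e, ‖logVec (su2Quat (V e))‖ ≤ 1 / 128) →
      ∀ (W U₀ : GaugeField (F.P K) 0 SU2), W ∈ fibre F ℰp J K hJK V → W ∈ histGood F ℰp θ' K J →
        U₀ ∈ fibre F ℰp J K hJK V → U₀ ∈ histGood F ℰp θ' K J →
      ∀ (wt : (j : ℕ) → PBond (F.P K) j → PBond (F.P K) (j + 1) → ℝ)
        (lift : (j : ℕ) → GaugeField (F.P K) (j + 1) SU2 → GaugeField (F.P K) j SU2)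
        (U₁ : GaugeField (F.P K) 0 SU2) (g g₀ : (j : ℕ) → Site (F.P K) j → SU2),
        (∀ j b e, wt j b e = if e.dir = b.dir ∧ (b.src b.dir - emb e.src b.dir).val < (F.P K).L then
          ∏ ν ∈ Finset.univ.erase b.dir, max 0 (1 - ((rel (emb e.src) b.src ν).natAbs : ℝ) / (F.P K).L) else 0) →
        (∀ j X b, lift j X b = expPoint (∑ e, wt j b e • ((((F.P K).L : ℕ) : ℝ)⁻¹ • logVec (su2Quat (X e))))) →
        (∀ j, K - J ≤ j → ∀ y, g j y = 1) →
        (∀ j, j < K - J → ∀ x,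
          axialT (GaugeField.gaugeAct (g j) (Averaging.iter (fun k => blockAvg (P := F.P K) (j := k) ℰp) j W)) (emb (blockOf x)) x =
            axialT (lift j (GaugeField.gaugeAct (g (j + 1)) (Averaging.iter (fun k => blockAvg (P := F.P K) (j := k) ℰp) (j + 1) W))) (emb (blockOf x)) x) →
        (∀ j, j < K - J →
          (blockAvg (P := F.P K) (j := j) ℰp).avg (GaugeField.gaugeAct (g j) (Averaging.iter (fun k => blockAvg (P := F.P K) (j := k) ℰp) j W)) =
            GaugeField.gaugeAct (g (j + 1)) (Averaging.iter (fun k => blockAvg (P := F.P K) (j := k) ℰp) (j + 1) W)) →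
        (∀ j, K - J ≤ j → ∀ y, g₀ j y = 1) →
        (∀ j, j < K - J → ∀ x,
          axialT (GaugeField.gaugeAct (g₀ j) (Averaging.iter (fun k => blockAvg (P := F.P K) (j := k) ℰp) j U₁)) (emb (blockOf x)) x =
            axialT (lift j (GaugeField.gaugeAct (g₀ (j + 1)) (Averaging.iter (fun k => blockAvg (P := F.P K) (j := k) ℰp) (j + 1) U₁))) (emb (blockOf x)) x) →
        (∀ j, j < K - J →
          (blockAvg (P := F.P K) (j := j) ℰp).avg (GaugeField.gaugeAct (g₀ j) (Averaging.iter (fun k => blockAvg (P := F.P K) (j := k) ℰp) j U₁)) =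
            GaugeField.gaugeAct (g₀ (j + 1)) (Averaging.iter (fun k => blockAvg (P := F.P K) (j := k) ℰp) (j + 1) U₁)) →
        (∀ X : GaugeField (F.P K) 0 SU2, Averaging.iter (fun k => blockAvg (P := F.P K) (j := k) ℰp) (K - J) (GaugeField.gaugeAct (fun x => (g 0 x)⁻¹) X) =
          Averaging.iter (fun k => blockAvg (P := F.P K) (j := k) ℰp) (K - J) X) →
        (∀ X : GaugeField (F.P K) 0 SU2, Averaging.iter (fun k => blockAvg (P := F.P K) (j := k) ℰp) (K - J) (GaugeField.gaugeAct (g₀ 0) X) =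
          Averaging.iter (fun k => blockAvg (P := F.P K) (j := k) ℰp) (K - J) X) →
        U₀ = GaugeField.gaugeAct (fun x => (g 0 x)⁻¹ * g₀ 0 x) U₁ →
        (∀ X : GaugeField (F.P K) 0 SU2, ∀ j, j ≤ K - J →
          Averaging.iter (fun k => blockAvg (P := F.P K) (j := k) ℰp) j (GaugeField.gaugeAct (g 0) X) =
            GaugeField.gaugeAct (g j) (Averaging.iter (fun k => blockAvg (P := F.P K) (j := k) ℰp) j X)) →
        (∀ X : GaugeField (F.P K) 0 SU2, ∀ j, j ≤ K - J →
          Averaging.iter (fun k => blockAvg (P := F.P K) (j := k) ℰp) j (GaugeField.gaugeAct (g₀ 0) X) =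
            GaugeField.gaugeAct (g₀ j) (Averaging.iter (fun k => blockAvg (P := F.P K) (j := k) ℰp) j X)) →
        ∃ M : ℕ → ℝ, (∀ t, 0 ≤ M t) ∧
          (∀ t, t ≤ K - J → ∀ b : PBond (F.P K) t,
            ‖logVec (su2Quat (Averaging.iter (fun k => blockAvg (P := F.P K) (j := k) ℰp) t W b *
              (Averaging.iter (fun k => blockAvg (P := F.P K) (j := k) ℰp) t U₀ b)⁻¹))‖ ≤ M t) ∧
          (∀ t, t ≤ K - J → M t ≤ 1 / 2) ∧ ∑ t ∈ Finset.range (K - J), M (t + 1) ≤ E := by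
  obtain ⟨E, hE, a₀, ha₀, S₀, hS₀, H⟩ := exists_supBudget_128_theta L hL
  refine ⟨E + E, by positivity, a₀, ha₀, S₀, hS₀, ?_⟩
  intro F θ' hFL hθ0 hθa J K hJK hθS V hV W U₀ hWf hWg hU₀f hU₀g wt lift U₁ g g₀ hwt hlift hT1 hT4 hT5 hT1' hT4' hT5' hT6 hT5r hU₀ hT3 hT3'
  -- the fibre mate `U₁`'s memberships (as in ✓p832020 §2)
  have hwres : ∀ X : GaugeField (F.P K) 0 SU2,
      descendTo F ℰp J K hJK (GaugeField.gaugeAct (fun x => (g 0 x)⁻¹ * g₀ 0 x) X) = descendTo F ℰp J K hJK X := by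
    refine residual_of_iter_eq F hJK _ fun X => ?_
    have e1 : GaugeField.gaugeAct (fun x => (g 0 x)⁻¹ * g₀ 0 x) X =
        GaugeField.gaugeAct (fun x => (g 0 x)⁻¹) (GaugeField.gaugeAct (g₀ 0) X) := gaugeAct_mul_eq (fun x => (g 0 x)⁻¹) (g₀ 0) X
    rw [e1, hT6, hT5r]
  have hU₁f : U₁ ∈ fibre F ℰp J K hJK V := by
    rw [← gaugeAct_mem_fibre_iff_of_residual F hJK hwres U₁, ← hU₀]; exact hU₀f
  have hU₁g : U₁ ∈ histGood F ℰp θ' K J := by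
    rw [← gaugeAct_mem_histGood_iff F (fun x => (g 0 x)⁻¹ * g₀ 0 x) θ' J U₁, ← hU₀]; exact hU₀g
  -- the two towers' arc profiles with their level sums
  obtain ⟨s, hs0, hs, hs4, hsE, _⟩ := H F θ' hFL hθ0 hθa J K hJK hθS V hV W hWf hWg g wt
    (fun t => lift t (GaugeField.gaugeAct (g (t + 1)) (Averaging.iter (fun k => blockAvg (P := F.P K) (j := k) ℰp) (t + 1) W)))
    (fun t _ b e => hwt t b e) (fun t _ b => hlift t _ b) hT1 (fun t ht z => hT4 t ht z) (fun t ht => hT5 t ht)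
  obtain ⟨s', hs0', hs', hs4', hsE', _⟩ := H F θ' hFL hθ0 hθa J K hJK hθS V hV U₁ hU₁f hU₁g g₀ wt
    (fun t => lift t (GaugeField.gaugeAct (g₀ (t + 1)) (Averaging.iter (fun k => blockAvg (P := F.P K) (j := k) ℰp) (t + 1) U₁)))
    (fun t _ b e => hwt t b e) (fun t _ b => hlift t _ b) hT1' (fun t ht z => hT4' t ht z) (fun t ht => hT5' t ht)
  refine ⟨fun t => s t + s' t, fun t => add_nonneg (hs0 t) (hs0' t), fun t ht b => ?_, fun t ht => by linarith [hs4 t ht, hs4' t ht], ?_⟩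
  · -- raw chord = stage chord (gauge move), then the arc triangle
    rw [norm_logVec_rawChord_eq_stageChord (fun k => blockAvg (P := F.P K) (j := k) ℰp) g g₀ W U₁ U₀ (fun X => hT3 X t ht) (fun X => hT3' X t ht) hU₀ b]
    exact (norm_logVec_mul_inv_le_add _ _).trans (add_le_add (hs t ht b) (hs' t ht b))
  · rw [Finset.sum_add_distrib]; exact add_le_add hsE hsE'

end Summit.QuantumFields.YangMills.Theorems.FluctuationComparisonRegPrIntLS2BetaGuardLettersTheta

end
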